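import Summits.Ventures.PercRepro.Night2TwoOneFaces

/-!
# PercRepro — the cell `(2, 1)` with EXACTLY two fat closures, no spread hypothesis: a lossy big covering set meets
each class once and has at most one non-fat face (night-2, gen 28)

The two-fat-closure clause of the `(2, 1)` residue with `H₀ = cl B₀ ≠ H₁ = cl B₁` the only fat closures and disjoint
missed pairs (classes `G ∖ H₀`, `G ∖ H₁`), WITHOUT the spread hypothesis of `Night2TwoOneFatFaces`.  A thin member
whose closure is neither `H₀` nor `H₁` misses `≥ 3` points and requests `≤ 7/30` (`req_le_of_not_fat`).  A covering
set `Q` of a thin member containing both points of one class has thin faces only at those two points (every other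
face has its complement inside the other hyperplane off the coloop, rank `4 < 5`), each requesting `≤ 7/30`: no loss
(`loss_eq_zero_of_two_in_class`, `loss_eq_zero_of_two_in_class'`).  So a lossy big covering set meets each class once
(`one_per_class_of_loss_ne_zero`); its plane part spans `P` with `≥ 4` points, it has at most one thin face at a plane
point (`plane_face_unique`), not fat, and `L1 Q ≤ 7/24 + 7/24 + 7/30 = 49/60`: the big-face losses of any set sum to
at most `49/60 − 11/18 = 37/180` (`faceLossP_sum_le_general`).
-/

namespace PercRepro.Shadow

open Finset PerFlat ThmH

variable {α : Type*} [DecidableEq α] {M : Matroid α} [M.Finite]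

section GeneralFaces

variable {G : Finset α}

/-- A thin member whose closure is neither fat closure requests at most `7/30`. -/
theorem req_le_of_not_fat (hG : G ∈ flatsQ M (5 + 1)) (hd : (gr M \ G).card = 2)
    {B₀ B₁ : Finset α} (hB₀ : B₀ ∈ thinMembers M 5 G) (hB₁ : B₁ ∈ thinMembers M 5 G)
    (hm₀ : (G \ clF M B₀).card ≤ 2) (hm₁ : (G \ clF M B₁).card ≤ 2) (hne : clF M B₀ ≠ clF M B₁)
    (hfat : (fatClosures M 5 G 2).card ≤ 2) {F : Finset α} (hF : F ∈ thinMembers M 5 G)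
    (h₀ : clF M F ≠ clF M B₀) (h₁ : clF M F ≠ clF M B₁) : req M 5 F ≤ 7 / 30 := by
  have hd' : (gr M \ G).card ≤ 5 := by omega
  have hm3 : 3 ≤ (G \ clF M F).card := by
    by_contra h
    have h2 : (G \ clF M F).card ≤ 2 := by omega
    rcases clF_eq_or_eq_of_fat hB₀ hB₁ hm₀ hm₁ hne hfat hF h2 with h | h
    · exact h₀ h
    · exact h₁ h
  rw [req_eq_of_thin hG hF, hd]
  unfold phiQ
  push_cast
  have h3 : (3 : ℚ) ≤ ((G \ clF M F).card : ℚ) := by exact_mod_cast hm3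
  rw [div_le_div_iff₀ (by linarith) (by norm_num)]
  linarith

/-- A thin face at a plane point requests at most `7/30` (its closure misses the plane point). -/
theorem req_le_of_plane_face' (hG : G ∈ flatsQ M (5 + 1)) (hd : (gr M \ G).card = 2)
    {B₀ B₁ : Finset α} (hB₀ : B₀ ∈ thinMembers M 5 G) (hB₁ : B₁ ∈ thinMembers M 5 G)
    (hm₀ : (G \ clF M B₀).card ≤ 2) (hm₁ : (G \ clF M B₁).card ≤ 2) (hne : clF M B₀ ≠ clF M B₁)
    (hfat : (fatClosures M 5 G 2).card ≤ 2) {F : Finset α} (hF : F ∈ thinMembers M 5 G) {w : α}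
    (hw : w ∈ clF M B₀ ∩ clF M B₁) (hwF : w ∉ clF M F) : req M 5 F ≤ 7 / 30 :=
  req_le_of_not_fat hG hd hB₀ hB₁ hm₀ hm₁ hne hfat hF (fun h => hwF (h ▸ (Finset.mem_inter.1 hw).1))
    (fun h => hwF (h ▸ (Finset.mem_inter.1 hw).2))

/-- A face `Q ∖ w` of a set `Q ⊇ K` at a point `w ∈ H` is no member when `G ∖ Q ⊆ H` (`H` a fat closure):
its complement lies in `H ∖ K`, of rank `4`. -/
theorem face_notMem_of_compl_subset (hG : G ∈ flatsQ M (5 + 1)) (hd : (gr M \ G).card = 2)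
    (hk : kColoops M G = 1) {B₁ : Finset α} (hB₁ : B₁ ∈ thinMembers M 5 G) {Q : Finset α} (hQG : Q ⊆ G)
    (hKQ : coloops M G ⊆ Q) (hcompl : G \ Q ⊆ clF M B₁) {w : α} (hwK : w ∉ coloops M G)
    (hwH : w ∈ clF M B₁) : Q.erase w ∉ Uq M (5 + 2) 5 := by
  intro hU
  have hsub : G \ Q.erase w ⊆ clF M B₁ \ coloops M G := by
    intro x hx
    rw [Finset.mem_sdiff, Finset.mem_erase, not_and] at hx
    rw [Finset.mem_sdiff]
    by_cases hxw : x = w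
    · exact ⟨hxw ▸ hwH, hxw ▸ hwK⟩
    · have hxQ : x ∉ Q := hx.2 hxw
      exact ⟨hcompl (Finset.mem_sdiff.2 ⟨hx.1, hxQ⟩), fun hK => hxQ (hKQ hK)⟩
  have h1 := rkN_mono (M := M) hsub
  have h2 := rkN_clF_sdiff_coloops_le_four_two hG hd hk hB₁
  have h5 := five_le_rkN_sdiff_of_mem_Uq_two hG hd hU ((Finset.erase_subset w Q).trans hQG)
  omega

open scoped Classical in
/-- **A COVERING SET CONTAINING BOTH POINTS OF THE CLASS `G ∖ H₁` LOSES NOTHING**: its thin faces are at those two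
points, each requesting `≤ 7/30`, so `L1 ≤ 7/15 < 11/18 ≤ capS`. -/
theorem loss_eq_zero_of_two_in_class (hG : G ∈ flatsQ M (5 + 1)) (hd : (gr M \ G).card = 2)
    (hk : kColoops M G = 1) {B₀ B₁ : Finset α} (hB₀ : B₀ ∈ thinMembers M 5 G) (hB₁ : B₁ ∈ thinMembers M 5 G)
    (hm₀ : (G \ clF M B₀).card ≤ 2) (hm₁ : (G \ clF M B₁).card ≤ 2) (hne : clF M B₀ ≠ clF M B₁)
    (hfat : (fatClosures M 5 G 2).card ≤ 2) (hdisj : Disjoint (G \ clF M B₀) (G \ clF M B₁))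
    {B : Finset α} (hB : B ∈ thinMembers M 5 G) {z : α} (hz : z ∈ G \ clF M B)
    (hsub : G \ clF M B₁ ⊆ insert z B) : loss M 5 G B z = 0 := by
  have hd' : (gr M \ G).card ≤ 5 := by omega
  have hB' : B ∈ membersIn M (Uq M (5 + 2) 5) G := (mem_thinMembers.1 hB).1
  have hBU : B ∈ Uq M (5 + 2) 5 := (mem_membersIn.1 hB').1
  have hBG : B ⊆ G := (subset_clF hBU).trans (mem_membersIn.1 hB').2
  have hKB : coloops M G ⊆ B := coloops_subset_of_mem_thinMembers hG hd' hB
  set Q := insert z B with hQ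
  have hQG : Q ⊆ G := Finset.insert_subset (Finset.mem_sdiff.1 hz).1 hBG
  have hKQ : coloops M G ⊆ Q := hKB.trans (Finset.subset_insert _ _)
  have hcompl : G \ Q ⊆ clF M B₁ := by
    intro x hx
    by_contra h
    exact (Finset.mem_sdiff.1 hx).2 (hsub (Finset.mem_sdiff.2 ⟨(Finset.mem_sdiff.1 hx).1, h⟩))
  set Pre := (coverPreimages M (Uq M (5 + 2) 5) G Q).filter (fun B => B ∉ lay0 M 5 G) with hPre
  have hthin : ∀ F ∈ Pre, F ∈ thinMembers M 5 G := by
    intro F hF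
    rw [hPre, Finset.mem_filter, mem_coverPreimages] at hF
    exact mem_thinMembers.2 ⟨hF.1.1, hF.2⟩
  have hnotcl : ∀ w ∈ Q, Q.erase w ∈ Pre → w ∉ clF M (Q.erase w) := by
    intro w hw hF
    rw [hPre, Finset.mem_filter, mem_coverPreimages] at hF
    obtain ⟨z', hz', hzS⟩ := mem_coverSets.1 hF.1.2
    have hzS' : z' ∈ Q := by rw [← hzS]; exact Finset.mem_insert_self _ _
    have hzne : z' ∉ Q.erase w := notMem_of_notMem_clF (mem_membersIn.1 hF.1.1).1 (Finset.mem_sdiff.1 hz').2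
    have hzw : z' = w := by
      by_contra h
      exact hzne (Finset.mem_erase.2 ⟨h, hzS'⟩)
    have := (Finset.mem_sdiff.1 hz').2
    rwa [hzw] at this
  -- the thin preimages are faces at the two class points
  have hPsub : Pre ⊆ (G \ clF M B₁).image (fun w => Q.erase w) := by
    intro F hF
    have h1 := thin_coverPreimages_subset_image_coloops hG hd' Q hF
    obtain ⟨w, hw, rfl⟩ := Finset.mem_image.1 h1
    have hwQ : w ∈ Q := (Finset.mem_sdiff.1 (mem_coloops.1 hw).1).1
    have hwK : w ∉ coloops M G := (Finset.mem_sdiff.1 (mem_coloops.1 hw).1).2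
    rw [Finset.mem_image]
    refine ⟨w, Finset.mem_sdiff.2 ⟨hQG hwQ, fun hwH => ?_⟩, rfl⟩
    exact face_notMem_of_compl_subset hG hd hk hB₁ hQG hKQ hcompl hwK hwH
      (mem_membersIn.1 (mem_thinMembers.1 (hthin _ hF)).1).1
  have hreq : ∀ F ∈ Pre, req M 5 F ≤ 7 / 30 := by
    intro F hF
    obtain ⟨w, hw, rfl⟩ := Finset.mem_image.1 (hPsub hF)
    have hwQ : w ∈ Q := hsub hw
    have hwH₀ : w ∈ clF M B₀ := by
      by_contra h
      exact Finset.disjoint_left.1 hdisj (Finset.mem_sdiff.2 ⟨(Finset.mem_sdiff.1 hw).1, h⟩) hw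
    apply req_le_of_not_fat hG hd hB₀ hB₁ hm₀ hm₁ hne hfat (hthin _ hF)
    · intro h
      exact hnotcl w hwQ hF (h ▸ hwH₀)
    · -- the other class point lies in the face and outside `H₁`
      intro h
      have hw2 : ∃ w' ∈ G \ clF M B₁, w' ≠ w := by
        by_contra hcon
        push Not at hcon
        have := Finset.card_le_card (fun x hx => Finset.mem_singleton.2 (hcon x hx) : G \ clF M B₁ ⊆ {w})
        rw [Finset.card_singleton] at this
        have := two_le_card_sdiff_of_not_lay0 hG hd' (mem_thinMembers.1 hB₁).1 (mem_thinMembers.1 hB₁).2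
        omega
      obtain ⟨w', hw', hw'w⟩ := hw2
      have hw'F : w' ∈ Q.erase w := Finset.mem_erase.2 ⟨hw'w, hsub hw'⟩
      have : w' ∈ clF M (Q.erase w) :=
        subset_clF (mem_membersIn.1 (mem_thinMembers.1 (hthin _ hF)).1).1 hw'F
      rw [h] at this
      exact (Finset.mem_sdiff.1 hw').2 this
  have hL1 : L1 M 5 G Q ≤ 7 / 15 := by
    unfold L1
    rw [← hPre]
    have hc : Pre.card ≤ 2 :=
      (Finset.card_le_card hPsub).trans (Finset.card_image_le.trans hm₁)
    calc ∑ F ∈ Pre, req M 5 F ≤ ∑ _F ∈ Pre, (7 / 30 : ℚ) := Finset.sum_le_sum hreq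
      _ = (Pre.card : ℚ) * (7 / 30) := by rw [Finset.sum_const, nsmul_eq_mul]
      _ ≤ 2 * (7 / 30) := by
          have : (Pre.card : ℚ) ≤ 2 := by exact_mod_cast hc
          nlinarith
      _ = 7 / 15 := by norm_num
  have hcap := capS_ge_eleven_eighteenths_two_one hd hk hQG
  have hfS : fS M 5 G Q = 1 := by
    unfold fS
    rw [if_pos (by linarith)]
  unfold loss
  rw [← hQ, hfS]
  ring

open scoped Classical in
/-- The mirror image: both points of the class `G ∖ H₀` in the covering set. -/
theorem loss_eq_zero_of_two_in_class' (hG : G ∈ flatsQ M (5 + 1)) (hd : (gr M \ G).card = 2)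
    (hk : kColoops M G = 1) {B₀ B₁ : Finset α} (hB₀ : B₀ ∈ thinMembers M 5 G) (hB₁ : B₁ ∈ thinMembers M 5 G)
    (hm₀ : (G \ clF M B₀).card ≤ 2) (hm₁ : (G \ clF M B₁).card ≤ 2) (hne : clF M B₀ ≠ clF M B₁)
    (hfat : (fatClosures M 5 G 2).card ≤ 2) (hdisj : Disjoint (G \ clF M B₀) (G \ clF M B₁))
    {B : Finset α} (hB : B ∈ thinMembers M 5 G) {z : α} (hz : z ∈ G \ clF M B)
    (hsub : G \ clF M B₀ ⊆ insert z B) : loss M 5 G B z = 0 := by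
  have hfat' : (fatClosures M 5 G 2).card ≤ 2 := hfat
  exact loss_eq_zero_of_two_in_class hG hd hk hB₁ hB₀ hm₁ hm₀ hne.symm hfat' hdisj.symm hB hz hsub

open scoped Classical in
/-- **A LOSSY COVERING SET OF A THIN MEMBER MEETS EACH CLASS EXACTLY ONCE** (exactly two fat closures, disjoint
missed pairs): a class absent from `Q ∖ K` leaves it inside a hyperplane off the coloop (rank `≤ 4 < 5`), a class
doubled in `Q` leaves no loss. -/
theorem one_per_class_of_loss_ne_zero (hG : G ∈ flatsQ M (5 + 1)) (hd : (gr M \ G).card = 2)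
    (hk : kColoops M G = 1) {B₀ B₁ : Finset α} (hB₀ : B₀ ∈ thinMembers M 5 G) (hB₁ : B₁ ∈ thinMembers M 5 G)
    (hm₀ : (G \ clF M B₀).card ≤ 2) (hm₁ : (G \ clF M B₁).card ≤ 2) (hne : clF M B₀ ≠ clF M B₁)
    (hfat : (fatClosures M 5 G 2).card ≤ 2) (hdisj : Disjoint (G \ clF M B₀) (G \ clF M B₁))
    {B : Finset α} (hB : B ∈ thinMembers M 5 G) {z : α} (hz : z ∈ G \ clF M B) (hl0 : loss M 5 G B z ≠ 0) :
    ∃ u u', insert z B ∩ (G \ clF M B₀) = {u} ∧ insert z B ∩ (G \ clF M B₁) = {u'} := by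
  have hd' : (gr M \ G).card ≤ 5 := by omega
  have hB' : B ∈ membersIn M (Uq M (5 + 2) 5) G := (mem_thinMembers.1 hB).1
  have hBU : B ∈ Uq M (5 + 2) 5 := (mem_membersIn.1 hB').1
  have hBG : B ⊆ G := (subset_clF hBU).trans (mem_membersIn.1 hB').2
  have hKB : coloops M G ⊆ B := coloops_subset_of_mem_thinMembers hG hd' hB
  set Q := insert z B with hQ
  have hQG : Q ⊆ G := Finset.insert_subset (Finset.mem_sdiff.1 hz).1 hBG
  have hQ5 : rkN M (Q \ coloops M G) = 5 := rkN_insert_sdiff_coloops_eq_five_of_thin hG hd hk hB hz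
  have hA2 : (G \ clF M B₀).card = 2 := by
    have := two_le_card_sdiff_of_not_lay0 hG hd' (mem_thinMembers.1 hB₀).1 (mem_thinMembers.1 hB₀).2
    omega
  have hB2 : (G \ clF M B₁).card = 2 := by
    have := two_le_card_sdiff_of_not_lay0 hG hd' (mem_thinMembers.1 hB₁).1 (mem_thinMembers.1 hB₁).2
    omega
  -- each class meets `Q`
  have hmeet : ∀ (C : Finset α), C ∈ thinMembers M 5 G → (Q ∩ (G \ clF M C)).card ≠ 0 := by
    intro C hC h0
    rw [Finset.card_eq_zero] at h0
    have hsub : Q \ coloops M G ⊆ clF M C \ coloops M G := by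
      intro x hx
      rw [Finset.mem_sdiff] at hx ⊢
      refine ⟨?_, hx.2⟩
      by_contra h
      have : x ∈ Q ∩ (G \ clF M C) := Finset.mem_inter.2 ⟨hx.1, Finset.mem_sdiff.2 ⟨hQG hx.1, h⟩⟩
      rw [h0] at this
      exact Finset.notMem_empty x this
    have h1 := rkN_mono (M := M) hsub
    have h2 := rkN_clF_sdiff_coloops_le_four_two hG hd hk hC
    omega
  -- no class is doubled in `Q`
  have hnot2 : ∀ (C : Finset α), C ∈ thinMembers M 5 G → (G \ clF M C).card = 2 →
      (G \ clF M C ⊆ Q → loss M 5 G B z = 0) → (Q ∩ (G \ clF M C)).card ≤ 1 := by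
    intro C hC hC2 hloss
    by_contra h
    push Not at h
    have hsub : G \ clF M C ⊆ Q := by
      have h1 : Q ∩ (G \ clF M C) ⊆ G \ clF M C := Finset.inter_subset_right
      have h2 : (Q ∩ (G \ clF M C)) = G \ clF M C := by
        apply Finset.eq_of_subset_of_card_le h1
        omega
      rw [← h2]; exact Finset.inter_subset_left
    exact hl0 (hloss hsub)
  have h₀ : (Q ∩ (G \ clF M B₀)).card = 1 := by
    have := hnot2 B₀ hB₀ hA2 (fun hsub => loss_eq_zero_of_two_in_class' hG hd hk hB₀ hB₁ hm₀ hm₁ hne hfat hdisj hB hz hsub)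
    have := hmeet B₀ hB₀
    omega
  have h₁ : (Q ∩ (G \ clF M B₁)).card = 1 := by
    have := hnot2 B₁ hB₁ hB2 (fun hsub => loss_eq_zero_of_two_in_class hG hd hk hB₀ hB₁ hm₀ hm₁ hne hfat hdisj hB hz hsub)
    have := hmeet B₁ hB₁
    omega
  obtain ⟨u, hu⟩ := Finset.card_eq_one.1 h₀
  obtain ⟨u', hu'⟩ := Finset.card_eq_one.1 h₁
  exact ⟨u, u', hu, hu'⟩

open scoped Classical in
/-- The layer-1 request of a set meeting both classes whose plane part spans `P` with `≥ 4` points, without the spread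
hypothesis: `≤ 7/24` per thin face at a class point and `≤ 7/30` for the unique thin face at a plane point. -/
theorem L1_le_of_spanning' (hG : G ∈ flatsQ M (5 + 1)) (hd : (gr M \ G).card = 2) (hk : kColoops M G = 1)
    (hs : ∀ e ∈ gr M, ∀ f ∈ gr M, e ≠ f → rkN M {e, f} = 2) {B₀ B₁ : Finset α}
    (hB₀ : B₀ ∈ thinMembers M 5 G) (hB₁ : B₁ ∈ thinMembers M 5 G) (hm₀ : (G \ clF M B₀).card ≤ 2)
    (hm₁ : (G \ clF M B₁).card ≤ 2) (hne : clF M B₀ ≠ clF M B₁) (hfat : (fatClosures M 5 G 2).card ≤ 2)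
    (hdisj : Disjoint (G \ clF M B₀) (G \ clF M B₁)) {S : Finset α} (hSG : S ⊆ G)
    (hSP3 : 3 ≤ rkN M (S ∩ ((clF M B₀ ∩ clF M B₁) \ coloops M G)))
    (hSP4 : 4 ≤ (S ∩ ((clF M B₀ ∩ clF M B₁) \ coloops M G)).card)
    {u u' : α} (hu : u ∈ S ∩ (G \ clF M B₀)) (hu' : u' ∈ S ∩ (G \ clF M B₁)) :
    L1 M 5 G S ≤ (((S ∩ ((G \ clF M B₀) ∪ (G \ clF M B₁))).filter
      (fun w => S.erase w ∈ thinMembers M 5 G)).card : ℚ) * (7 / 24) + 7 / 30 := by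
  have hd' : (gr M \ G).card ≤ 5 := by omega
  set Pre := (coverPreimages M (Uq M (5 + 2) 5) G S).filter (fun B => B ∉ lay0 M 5 G) with hPre
  set W := (S \ coloops M G).filter (fun w => S.erase w ∈ Pre) with hW
  have hthin : ∀ F ∈ Pre, F ∈ thinMembers M 5 G := by
    intro F hF
    rw [hPre, Finset.mem_filter, mem_coverPreimages] at hF
    exact mem_thinMembers.2 ⟨hF.1.1, hF.2⟩
  have hnotcl : ∀ w ∈ S, S.erase w ∈ Pre → w ∉ clF M (S.erase w) := by
    intro w hw hF
    rw [hPre, Finset.mem_filter, mem_coverPreimages] at hF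
    obtain ⟨z, hz, hzS⟩ := mem_coverSets.1 hF.1.2
    have hzS' : z ∈ S := by rw [← hzS]; exact Finset.mem_insert_self _ _
    have hzne : z ∉ S.erase w := notMem_of_notMem_clF (mem_membersIn.1 hF.1.1).1 (Finset.mem_sdiff.1 hz).2
    have hzw : z = w := by
      by_contra h
      exact hzne (Finset.mem_erase.2 ⟨h, hzS'⟩)
    have := (Finset.mem_sdiff.1 hz).2
    rwa [hzw] at this
  have hPreEq : Pre = W.image (fun w => S.erase w) := by
    ext F
    rw [Finset.mem_image]
    constructor
    · intro hF
      have h1 := thin_coverPreimages_subset_image_coloops hG hd' S hF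
      obtain ⟨w, hw, rfl⟩ := Finset.mem_image.1 h1
      exact ⟨w, Finset.mem_filter.2 ⟨(mem_coloops.1 hw).1, hF⟩, rfl⟩
    · rintro ⟨w, hw, rfl⟩
      exact (Finset.mem_filter.1 hw).2
  have hL1 : L1 M 5 G S = ∑ w ∈ W, req M 5 (S.erase w) := by
    unfold L1
    rw [← hPre, hPreEq]
    apply Finset.sum_image
    intro w hw w' hw' heq
    exact Finset.erase_injOn S (Finset.mem_sdiff.1 (Finset.mem_filter.1 hw).1).1
      (Finset.mem_sdiff.1 (Finset.mem_filter.1 hw').1).1 heq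
  set Xs := (G \ clF M B₀) ∪ (G \ clF M B₁) with hXs
  rw [hL1, ← Finset.sum_filter_add_sum_filter_not W (fun w => w ∈ Xs)]
  have h1 : ∑ w ∈ W.filter (fun w => w ∈ Xs), req M 5 (S.erase w) ≤
      (((S ∩ Xs).filter (fun w => S.erase w ∈ thinMembers M 5 G)).card : ℚ) * (7 / 24) := by
    have hsub : W.filter (fun w => w ∈ Xs) ⊆ (S ∩ Xs).filter (fun w => S.erase w ∈ thinMembers M 5 G) := by
      intro w hw
      rw [Finset.mem_filter, hW, Finset.mem_filter, Finset.mem_sdiff] at hw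
      exact Finset.mem_filter.2 ⟨Finset.mem_inter.2 ⟨hw.1.1.1, hw.2⟩, hthin _ hw.1.2⟩
    calc ∑ w ∈ W.filter (fun w => w ∈ Xs), req M 5 (S.erase w)
        ≤ ∑ _w ∈ W.filter (fun w => w ∈ Xs), (7 / 24 : ℚ) := by
          apply Finset.sum_le_sum
          intro w hw
          exact req_le_of_thin_two_one hG hd (hthin _ (Finset.mem_filter.1 (Finset.mem_filter.1 hw).1).2)
      _ = ((W.filter (fun w => w ∈ Xs)).card : ℚ) * (7 / 24) := by rw [Finset.sum_const, nsmul_eq_mul]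
      _ ≤ _ := by
          apply mul_le_mul_of_nonneg_right _ (by norm_num)
          exact_mod_cast Finset.card_le_card hsub
  have hplane : ∀ w ∈ W.filter (fun w => ¬ w ∈ Xs), w ∈ S ∩ ((clF M B₀ ∩ clF M B₁) \ coloops M G) := by
    intro w hw
    rw [Finset.mem_filter, hW, Finset.mem_filter, Finset.mem_sdiff] at hw
    have hwG : w ∈ G := hSG hw.1.1.1
    rw [hXs, Finset.mem_union, Finset.mem_sdiff, Finset.mem_sdiff, not_or, not_and, not_and] at hw
    rw [Finset.mem_inter, Finset.mem_sdiff, Finset.mem_inter]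
    exact ⟨hw.1.1.1, ⟨not_not.1 (hw.2.1 hwG), not_not.1 (hw.2.2 hwG)⟩, hw.1.1.2⟩
  have h2 : ∑ w ∈ W.filter (fun w => ¬ w ∈ Xs), req M 5 (S.erase w) ≤ 7 / 30 := by
    have hcard : (W.filter (fun w => ¬ w ∈ Xs)).card ≤ 1 := by
      apply Finset.card_le_one.2
      intro w₁ hw₁ w₂ hw₂
      exact plane_face_unique hG hd hk hs hB₀ hB₁ hdisj hSG hSP3 hSP4 hu hu' (hplane w₁ hw₁) (hplane w₂ hw₂)
        (hthin _ (Finset.mem_filter.1 (Finset.mem_filter.1 hw₁).1).2)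
        (hthin _ (Finset.mem_filter.1 (Finset.mem_filter.1 hw₂).1).2)
    calc ∑ w ∈ W.filter (fun w => ¬ w ∈ Xs), req M 5 (S.erase w)
        ≤ ∑ _w ∈ W.filter (fun w => ¬ w ∈ Xs), (7 / 30 : ℚ) := by
          apply Finset.sum_le_sum
          intro w hw
          have hwS : w ∈ S := (Finset.mem_sdiff.1 (Finset.mem_filter.1 (Finset.mem_filter.1 hw).1).1).1
          have hwP := hplane w hw
          exact req_le_of_plane_face' hG hd hB₀ hB₁ hm₀ hm₁ hne hfat
            (hthin _ (Finset.mem_filter.1 (Finset.mem_filter.1 hw).1).2)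
            (Finset.mem_sdiff.1 (Finset.mem_inter.1 hwP).2).1
            (hnotcl w hwS (Finset.mem_filter.1 (Finset.mem_filter.1 hw).1).2)
      _ = ((W.filter (fun w => ¬ w ∈ Xs)).card : ℚ) * (7 / 30) := by rw [Finset.sum_const, nsmul_eq_mul]
      _ ≤ 1 * (7 / 30) := by
          apply mul_le_mul_of_nonneg_right _ (by norm_num)
          exact_mod_cast hcard
      _ = 7 / 30 := by norm_num
  linarith

end GeneralFaces

end PercRepro.Shadow
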